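import Summits.QuantumFields.BalabanUV.Beta.D1BFx.PackedColumnBlockTotalMass

/-!
# `BalabanUV.Beta.D1BFx.PackedMultiplierSlotLetters` — road «BF-x» for binder row D1, slot (K), PART 24 letter «M-pack» AT THE CHART OF RECORD (α′), «K0-MIX-PACK» FILE B′:
# **THE SLOT LETTERS OF THE MULTIPLIER ∕ MIXED PACKED ROWS FROM THE TABLES' LOCALISATION** — a `VertexFamily M n C δ` multiplier table has UNIFORM per-coarse-slot
# weighted block masses `≤ 16·C·Zl 4 (δ∕2)²`; a `LocStencilFM n M₂ C δ` mixed table has FINE-BLOCK × COARSE-SLOT plain totals `≤ n⁴·(16·C·Zl 4 (δ∕2)²·e^{4δ})·e^{−δ|w − y₁|₁}`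
# at its OWN (`n`-free) rate, with NO `e^{δ·D·n}` offset cost

HONEST DEPENDENCY (cell records, verbatim): «continuum YM on T⁴ ⇐ BetaPertH ∧ nine spine estimates (0/9 proved); BetaPertH ⇐ (D1) ∧ (D4) ∧
CAP+tail; G-an2-4 gates asym, D1 and NE2/3/4.»  HONEST FRAMING (cell contract, verbatim): «discharging `BetaPertH` makes Bałaban's UV stability
UNCONDITIONAL — a real constructive-QFT result; it is NOT the continuum limit and NOT the Clay problem.»  THIS MODULE DISCHARGES NOTHING of the
wall: [folklore] `ℓ¹` bookkeeping over lit `ExpKernelCalculus.BiLoc ∕ VertexFamily ∕ Zl ∕ tsum_exp_shift'`, `SecondOrderResponse.LocStencilFM`, this lineage's FILE 2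
`PackedColumnBlockTotalMass.l1_toSite_le_of_mem_box` and `PackedKernelSplit.blk`.  No definition, no `def … : Prop`, nothing cited, 0 sorry.  Every table letter is a DISPLAYED hypothesis on an ARBITRARY family; NO (1.22) row is proved; per-word absolute-value
letters are INTERMEDIATE lemmas (an2 R-D1-g45-4 (3): the END's closing step is the PAIRED second variation); 0 root-level binders of row D1 discharged (hW ∕ hR-sockets ∕
hSX-socket ∕ D1Tel ∕ D1Rep = 0); (J1) ONE OPEN ROW; (K) NOT closed; NOT D1, NEVER «G-an2-4 closed», NOT `BetaPertH`, NOT continuum, NOT Clay.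

ABSOLUTE RULE (cell charter, verbatim): «No internally-minted statement may enter as a cited fact. Every hypothesis is either kernel-proved in
this package or a verbatim quotation of a PUBLISHED theorem with page reference. The manuscript(s) under audit are NOT citable for their own
disputed steps — they are the thing under adjudication; programme-internal (2001/route/tribunal) claims are never citable.»

WHY.  The OWNER's PART 24-hyb HEAD (d1-p2 g24 `PART24-HEAD-SPEC-g24.v1_1.md`) displays, at the STRAIGHT pin `K₀ := KInvStep n 0` of the chart of record (α′), the
smooth second-order words `W^s := vertex2OfK K₀ S₂⁰ + mixOfK K₀ M₂ + swap + response^s` ((H3-lit); the (D-R) rest `½·tadpole G′ ((W^s − vertex2OfK K₀ S₂⁰) + …)` of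
(H3-Δ) carries `mixOfK K₀ n M₂ μ y ν y′ + mixOfK K₀ n M₂ ν y′ μ y`) and the multiplier-column vertex `V^M := vertexOfM K₀ n (tabs.M 0)` inside the displaced word
`W^{M}` ((H2-M)); d1-leaf-01's TT16 `DressedMixVertexSplit`: «`vertexOfM` is NOT dressed, `mixOfK G₀ n M₂ = mixOfK K₀ n M₂ + [Λc μ y, V^M ν y′]`».  This lineage's
«K0-PACK» (g60, FILEs A–D) typed the packed rows of `vertexOfK` ∕ `vertex2OfK` at `K₀` and named «the `mixOfK` ∕ `dM∘K2OfK` parts of `W^{smooth}` (colM-weighted)»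
as NOT there.  «K0-MIX-PACK» = THREE files: FILE A′ (this lineage's `PackedMultiplierColumnMass`: the K-generic rows, the multiplier slot carried on the coarse
sublattice by lit `InterLevelTransport.onLat ∕ cwsum` — the DEFINITION of `vertexOfM` — so that FILE 2 §1 and FILE 4 §2 apply BY NAME), FILE B′ (`PackedMultiplierSlotLetters`:
the slot letters from `VertexFamily` ∕ `LocStencilFM` localisation), FILE C′ (`PackedStraightColumnMixedMass`: the straight pin, powers displayed).

CONTENT of FILE B′ (`d = 3`, block side `n`, `[NeZero n]`; all [folklore]).
* **`weightedMass_blk_le_of_biLoc`** (`BiLoc K u u C δ`, `σ ≤ δ∕2` ⟹ every block has summable `u`-centred `σ`-weighted mass `≤ 16·C·Zl 4 (δ∕2)²` — the VALUE of d1-leaf-01's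
  `RestKernelSandwichLoc.mass_le_of_biLoc` on a block, re-derived in 40 lines so that the mass files do not import the RK-SAND chain).
* **`slotMass_le_of_vertexFamily`** (`VertexFamily M n C δ`, `σ ≤ δ∕2` ⟹ the `hMs ∕ hMm` letters of FILE A′ `mass_blk_vertexOfM_le_of_slotMass` with `T j k := 16·C·Zl 4 (δ∕2)²`).
* **`exp_blockSlot_offset_le`** (`e^{−δ|n•y₁ + b − n•w|₁} ≤ e^{4δ}·e^{−δ|w − y₁|₁}` for `b ∈ box 4 n`, `0 ≤ δ`: the fine-block × coarse-slot offset at an `n`-FREE rate — for `|w − y₁|₁ ≤ 4`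
  trivially, beyond by the triangle inequality and `(n − 1)(|w − y₁|₁ − 4) ≥ 0`; FILE 2's `exp_block_offset_le` is the BLOCK-scale-rate companion paying `e^{ρDn}`).
* **`blockSlotTotal_le_of_locStencilFM`** (`LocStencilFM n M₂ C δ`, `0 < δ` ⟹ the `hPs ∕ hPB` letters of FILE A′ `mass_blk_mixOfK_le_of_blockSlotTotal` with
  `T j i := n⁴·(16·C·Zl 4 (δ∕2)²·e^{4δ})`, `θ := δ`).
NOT HERE (honest): the rows themselves (FILE A′ ∕ C′); any localisation letter of any ACTUAL table (an1's `tabs.M 0`: a `VertexFamily` letter; an1 ∕ an2's `M2Of 3 n tabs.mixFF 0`: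
`CombHId2W2Record.exists_locStencilFM_M2comb` — their constants' `n`-law is the table author's); any (1.22) row.
Unit `b2b-balaban-gan24-formalise-leaf-05` (gen 61), G-an2-4 swarm leaf prover 05, road «BF-x» supplier; INTENT-1 «K0-MIX-PACK» FILE B′ (journal [GAN24LEAF05-G61-INTENT-1] ∕ A-1).
-/

noncomputable section

open Finset
open scoped BigOperators
open Literature.MathematicalPhysics.QuantumFieldTheory
open Literature.MathematicalPhysics.QuantumFieldTheory.Balaban1983to89
open Literature.MathematicalPhysics.QuantumFieldTheory.Balaban1983to89.Beta
open B12Sec2to5 (l1 l1_nonneg)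
open ExpKernelCalculus (Site MKer Zl Zl_pos Zl_nonneg l1_natSmul)
open AffineAveraging (box toSite)
open OneStepResolventKernel (Fib)
open Summit.QuantumFields.BalabanUV.Beta.D1BFx.PackedKernelSplit (blk)

namespace Summit.QuantumFields.BalabanUV.Beta.D1BFx.PackedMultiplierSlotLetters

/-! ## §1 The slot letters of «K-MULT-MASS» ∕ «K-MIX-MASS» from `VertexFamily` ∕ `LocStencilFM` localisation (the table authors' letter SHAPES) -/

section Adapters

variable (n : ℕ) [NeZero n]

omit [NeZero n] in
/-- [folklore] **WEIGHTED BLOCK MASS OF A SELF-BI-LOCALISED KERNEL** (fibre `Fib 3`, blocks of fibre `Fin 4`): `BiLoc K u u C δ` (`0 ≤ C`, `0 < δ`) and `σ ≤ δ∕2` give, for every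
block `(j, k)`, a summable `u`-centred `σ`-weighted mass `≤ 16·C·Zl 4 (δ∕2)²` — termwise majorant `C·e^{−(δ∕2)|x−u|₁}·e^{−(δ∕2)|z−u|₁}`, the product of two shifted geometric
lattice sums (`tsum_exp_shift'`).  (The VALUE of d1-leaf-01's `RestKernelSandwichLoc.mass_le_of_biLoc` on a block, re-derived so that the mass files do not import the RK-SAND chain.) -/
theorem weightedMass_blk_le_of_biLoc {K : MKer 4 (Fib 3)} {u : Site 4} {C δ σ : ℝ} (hK : ExpKernelCalculus.BiLoc K u u C δ) (hC : 0 ≤ C) (hδ : 0 < δ)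
    (hσ : σ ≤ δ / 2) (j k : Bool) :
    (Summable fun p : Site 4 × Site 4 => ∑ g, ∑ f, |blk K j k p.1 p.2 g f| * Real.exp (σ * (l1 (p.1 - u) + l1 (p.2 - u)))) ∧
      ∑' p : Site 4 × Site 4, ∑ g, ∑ f, |blk K j k p.1 p.2 g f| * Real.exp (σ * (l1 (p.1 - u) + l1 (p.2 - u)))
        ≤ 16 * C * Zl 4 (δ / 2) ^ 2 := by
  have hδ2 : 0 < δ / 2 := half_pos hδ
  -- termwise majorant
  have hpt : ∀ (x z : Site 4) (g f : Fin (3 + 1)), |blk K j k x z g f| * Real.exp (σ * (l1 (x - u) + l1 (z - u)))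
      ≤ C * (Real.exp (-(δ / 2) * l1 (x - u)) * Real.exp (-(δ / 2) * l1 (z - u))) := by
    intro x z g f
    have h1 := hK x z (PackedKernelSplit.inj j g) (PackedKernelSplit.inj k f)
    have hl : 0 ≤ l1 (x - u) + l1 (z - u) := add_nonneg (l1_nonneg _) (l1_nonneg _)
    calc |blk K j k x z g f| * Real.exp (σ * (l1 (x - u) + l1 (z - u)))
        ≤ C * Real.exp (-δ * (l1 (x - u) + l1 (z - u))) * Real.exp (σ * (l1 (x - u) + l1 (z - u))) :=
          mul_le_mul_of_nonneg_right h1 (Real.exp_nonneg _)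
      _ = C * Real.exp ((σ - δ) * (l1 (x - u) + l1 (z - u))) := by
          rw [mul_assoc, ← Real.exp_add]; ring_nf
      _ ≤ C * Real.exp (-(δ / 2) * (l1 (x - u) + l1 (z - u))) := by
          refine mul_le_mul_of_nonneg_left (Real.exp_le_exp.2 ?_) hC
          exact mul_le_mul_of_nonneg_right (by linarith) hl
      _ = C * (Real.exp (-(δ / 2) * l1 (x - u)) * Real.exp (-(δ / 2) * l1 (z - u))) := by
          rw [mul_add, Real.exp_add]
  set G : Site 4 × Site 4 → ℝ := fun p => 16 * C * (Real.exp (-(δ / 2) * l1 (p.1 - u)) * Real.exp (-(δ / 2) * l1 (p.2 - u))) with hG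
  have hGs : Summable G :=
    ((ExpKernelCalculus.summable_exp_shift' hδ2 u).mul_of_nonneg (ExpKernelCalculus.summable_exp_shift' hδ2 u)
      (fun _ => (Real.exp_pos _).le) (fun _ => (Real.exp_pos _).le)).mul_left (16 * C)
  have hle : ∀ p : Site 4 × Site 4, ∑ g, ∑ f, |blk K j k p.1 p.2 g f| * Real.exp (σ * (l1 (p.1 - u) + l1 (p.2 - u))) ≤ G p := by
    intro p
    calc ∑ g, ∑ f, |blk K j k p.1 p.2 g f| * Real.exp (σ * (l1 (p.1 - u) + l1 (p.2 - u)))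
        ≤ ∑ _g : Fin (3 + 1), ∑ _f : Fin (3 + 1), C * (Real.exp (-(δ / 2) * l1 (p.1 - u)) * Real.exp (-(δ / 2) * l1 (p.2 - u))) :=
          Finset.sum_le_sum fun g _ => Finset.sum_le_sum fun f _ => hpt p.1 p.2 g f
      _ = G p := by
          simp only [Finset.sum_const, Finset.card_univ, Fintype.card_fin, nsmul_eq_mul, hG]
          push_cast
          ring
  have h0 : ∀ p : Site 4 × Site 4, 0 ≤ ∑ g, ∑ f, |blk K j k p.1 p.2 g f| * Real.exp (σ * (l1 (p.1 - u) + l1 (p.2 - u))) :=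
    fun p => Finset.sum_nonneg fun g _ => Finset.sum_nonneg fun f _ => by positivity
  have hs : Summable fun p : Site 4 × Site 4 => ∑ g, ∑ f, |blk K j k p.1 p.2 g f| * Real.exp (σ * (l1 (p.1 - u) + l1 (p.2 - u))) :=
    Summable.of_nonneg_of_le h0 hle hGs
  refine ⟨hs, ?_⟩
  calc ∑' p : Site 4 × Site 4, ∑ g, ∑ f, |blk K j k p.1 p.2 g f| * Real.exp (σ * (l1 (p.1 - u) + l1 (p.2 - u)))
      ≤ ∑' p, G p := hs.tsum_le_tsum hle hGs
    _ = 16 * C * Zl 4 (δ / 2) ^ 2 := by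
        have hn : Summable fun x : Site 4 => ‖Real.exp (-(δ / 2) * l1 (x - u))‖ := by
          simpa only [Real.norm_eq_abs, abs_of_nonneg (Real.exp_pos _).le] using ExpKernelCalculus.summable_exp_shift' hδ2 u
        rw [hG, tsum_mul_left, ← tsum_mul_tsum_of_summable_norm hn hn, ExpKernelCalculus.tsum_exp_shift']
        ring

omit [NeZero n] in
/-- [folklore] **THE MULTIPLIER TABLE's SLOT LETTERS FROM A `VertexFamily` LOCALISATION** (the SHAPE of an1's multiplier-table letters, e.g. a `VertexFamily (tabs.M 0) n C δ`):
`VertexFamily M n C δ` (`0 < δ`) and `σ ≤ δ∕2` give the two hypotheses `hMs ∕ hMm` of `mass_blk_vertexOfM_le_of_slotMass` with the UNIFORM letter `T j k := 16·C·Zl 4 (δ∕2)²`. -/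
theorem slotMass_le_of_vertexFamily {M : Fin (3 + 1) → (Fin (3 + 1) → ℤ) → MKer 4 (Fib 3)} {C δ σ : ℝ}
    (hM : ExpKernelCalculus.VertexFamily M n C δ) (hδ : 0 < δ) (hσ : σ ≤ δ / 2) (ρ : Fin (3 + 1)) (w : Fin (3 + 1) → ℤ) (j k : Bool) :
    (Summable fun p : Site 4 × Site 4 =>
        ∑ g, ∑ f, |blk (M ρ w) j k p.1 p.2 g f| * Real.exp (σ * (l1 (p.1 - (n : ℤ) • w) + l1 (p.2 - (n : ℤ) • w)))) ∧
      ∑' p : Site 4 × Site 4,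
          ∑ g, ∑ f, |blk (M ρ w) j k p.1 p.2 g f| * Real.exp (σ * (l1 (p.1 - (n : ℤ) • w) + l1 (p.2 - (n : ℤ) • w)))
        ≤ 16 * C * Zl 4 (δ / 2) ^ 2 :=
  weightedMass_blk_le_of_biLoc (hM ρ w) ((hM 0 0).nonneg (Sum.inl 0)) hδ hσ j k

/-- [folklore] **THE FINE-BLOCK × COARSE-SLOT OFFSET AT AN `n`-FREE RATE, WITHOUT THE `e^{δ·D·n}` COST**: for `0 ≤ δ`, `b ∈ box 4 n` and coarse `y₁, w`,
`e^{−δ|n•y₁ + b − n•w|₁} ≤ e^{4δ}·e^{−δ|w − y₁|₁}` — for `|w − y₁|₁ ≤ 4` the left side is `≤ 1 ≤ e^{4δ − δ|w−y₁|₁}`; for `|w − y₁|₁ ≥ 4` the triangle inequality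
`|n•y₁ + b − n•w|₁ ≥ n|w − y₁|₁ − 4n` and `(n − 1)(|w − y₁|₁ − 4) ≥ 0`.  (FILE 2's `exp_block_offset_le` trades the in-block offset for `e^{ρDn}` at a BLOCK-scale rate;
here the rate is the table's own, `n`-free, and the decay is kept in block units at that rate.) -/
theorem exp_blockSlot_offset_le {δ : ℝ} (hδ : 0 ≤ δ) (y₁ w : Fin (3 + 1) → ℤ) {b : Fin (3 + 1) → ℕ} (hb : b ∈ box (3 + 1) n) :
    Real.exp (-δ * l1 ((n : ℤ) • y₁ + toSite b - (n : ℤ) • w)) ≤ Real.exp (4 * δ) * Real.exp (-δ * l1 (w - y₁)) := by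
  rw [← Real.exp_add]
  refine Real.exp_le_exp.2 ?_
  have hn1 : (1 : ℝ) ≤ (n : ℝ) := by exact_mod_cast Nat.one_le_iff_ne_zero.mpr (NeZero.ne n)
  set u : Fin (3 + 1) → ℤ := (n : ℤ) • y₁ + toSite b with hu
  set l : ℝ := l1 (w - y₁) with hl
  have hl0 : 0 ≤ l := l1_nonneg _
  have hL0 : 0 ≤ l1 (u - (n : ℤ) • w) := l1_nonneg _
  rcases le_total l 4 with h4 | h4
  · nlinarith
  · -- `n·l ≤ |u − n•w|₁ + |toSite b|₁ ≤ |u − n•w|₁ + 4n`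
    have t : l1 ((n : ℤ) • y₁ - (n : ℤ) • w) ≤ l1 ((n : ℤ) • y₁ - u) + l1 (u - (n : ℤ) • w) := ExpKernelCalculus.l1_sub_triangle _ u _
    have e1 : l1 ((n : ℤ) • y₁ - (n : ℤ) • w) = (n : ℝ) * l := by
      rw [hl, ← smul_sub, l1_natSmul, ExpKernelCalculus.l1_sub_symm]
    have e2 : l1 ((n : ℤ) • y₁ - u) = l1 (toSite b) := by
      rw [ExpKernelCalculus.l1_sub_symm, hu, add_sub_cancel_left]
    rw [e1, e2] at t
    have hb' := PackedColumnBlockTotalMass.l1_toSite_le_of_mem_box hb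
    have hb4 : l1 (toSite b) ≤ 4 * (n : ℝ) := by
      refine hb'.trans (le_of_eq ?_); push_cast; ring
    have key : 0 ≤ δ * (((n : ℝ) - 1) * (l - 4)) := mul_nonneg hδ (mul_nonneg (by linarith) (by linarith))
    nlinarith [key, t, hb4, hδ]

/-- [folklore] **THE MIXED TABLE's SLOT LETTERS FROM A `LocStencilFM` LOCALISATION** (the SHAPE of an1 ∕ an2's mixed-table letters, e.g.
`CombHId2W2Record.exists_locStencilFM_M2comb`): `LocStencilFM n M₂ C δ` (`0 < δ`) gives the two hypotheses `hPs ∕ hPB` of `mass_blk_mixOfK_le_of_blockSlotTotal` with the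
FINE-BLOCK × COARSE-SLOT letter `T j i := n⁴·(16·C·Zl 4 (δ∕2)²·e^{4δ})` at the table's OWN rate `θ := δ` — per slot the plain block mass is `≤ 16·(C·e^{−δ|u − n•w|₁})·Zl 4 (δ∕2)²`
(`weightedMass_blk_le_of_biLoc` at weight `0`), `n⁴` slots per block, the offset by `exp_blockSlot_offset_le` (no `e^{δDn}`). -/
theorem blockSlotTotal_le_of_locStencilFM {M₂ : Fin (3 + 1) → (Fin (3 + 1) → ℤ) → Fin (3 + 1) → (Fin (3 + 1) → ℤ) → MKer 4 (Fib 3)} {C δ : ℝ}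
    (hM : SecondOrderResponse.LocStencilFM n M₂ C δ) (hδ : 0 < δ) :
    (∀ (κ : Fin (3 + 1)) (u : Fin (3 + 1) → ℤ) (ρ' : Fin (3 + 1)) (w : Fin (3 + 1) → ℤ) (j i : Bool),
        Summable fun p : Site 4 × Site 4 => ∑ g, ∑ f, |blk (M₂ κ u ρ' w) j i p.1 p.2 g f|) ∧
      ∀ (κ ρ' : Fin (3 + 1)) (y₁ w : Fin (3 + 1) → ℤ) (j i : Bool), ∑ b ∈ box (3 + 1) n,
        (∑' p : Site 4 × Site 4, ∑ g, ∑ f, |blk (M₂ κ ((n : ℤ) • y₁ + toSite b) ρ' w) j i p.1 p.2 g f|)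
          ≤ ((n : ℝ) ^ 4 * (16 * C * Zl 4 (δ / 2) ^ 2 * Real.exp (4 * δ))) * Real.exp (-δ * l1 (w - y₁)) := by
  have hC : 0 ≤ C := hM.nonneg
  -- per slot: the plain block mass (weight rate `0`) from the bi-localisation with constant `C·e^{−δ|u − n•w|₁}`
  have hslot : ∀ (κ : Fin (3 + 1)) (u : Fin (3 + 1) → ℤ) (ρ' : Fin (3 + 1)) (w : Fin (3 + 1) → ℤ) (j i : Bool),
      (Summable fun p : Site 4 × Site 4 => ∑ g, ∑ f, |blk (M₂ κ u ρ' w) j i p.1 p.2 g f|) ∧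
        ∑' p : Site 4 × Site 4, ∑ g, ∑ f, |blk (M₂ κ u ρ' w) j i p.1 p.2 g f|
          ≤ 16 * (C * Real.exp (-δ * l1 (u - (n : ℤ) • w))) * Zl 4 (δ / 2) ^ 2 := by
    intro κ u ρ' w j i
    have h := weightedMass_blk_le_of_biLoc (σ := 0) (hM κ u ρ' w) (by positivity) hδ (by positivity) j i
    simp only [zero_mul, Real.exp_zero, mul_one] at h
    exact h
  refine ⟨fun κ u ρ' w j i => (hslot κ u ρ' w j i).1, fun κ ρ' y₁ w j i => ?_⟩
  have hcard : ((box (3 + 1) n).card : ℝ) = (n : ℝ) ^ 4 := by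
    have h : (box (3 + 1) n).card = n ^ (3 + 1) := by simp [AffineAveraging.box, Fintype.card_piFinset]
    rw [h]; push_cast; ring
  calc ∑ b ∈ box (3 + 1) n, (∑' p : Site 4 × Site 4, ∑ g, ∑ f, |blk (M₂ κ ((n : ℤ) • y₁ + toSite b) ρ' w) j i p.1 p.2 g f|)
      ≤ ∑ b ∈ box (3 + 1) n, 16 * (C * (Real.exp (4 * δ) * Real.exp (-δ * l1 (w - y₁)))) * Zl 4 (δ / 2) ^ 2 := by
        refine Finset.sum_le_sum fun b hb => (hslot κ _ ρ' w j i).2.trans ?_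
        have ho := exp_blockSlot_offset_le n hδ.le y₁ w hb
        have hZ : 0 ≤ Zl 4 (δ / 2) ^ 2 := sq_nonneg _
        gcongr
    _ = ((n : ℝ) ^ 4 * (16 * C * Zl 4 (δ / 2) ^ 2 * Real.exp (4 * δ))) * Real.exp (-δ * l1 (w - y₁)) := by
        rw [Finset.sum_const, nsmul_eq_mul, hcard]; ring

end Adapters

end Summit.QuantumFields.BalabanUV.Beta.D1BFx.PackedMultiplierSlotLetters

end
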